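import Literature.AlgebraicGeometry.Hyperkaehler.GeneralizedKummerType
import Literature.AlgebraicGeometry.HodgeTheory.LefschetzStandardConjectureFacts
import HarnessLib

/-!
# Foster 2024: the Lefschetz standard conjecture `B` for projective varieties of `Kumⁿ`-type with `n + 1` prime — NAMED FACT

Layer `Literature/AlgebraicGeometry/Hyperkaehler`.  CITE record for the cell `hodge-kum4` (ladder HodgeAV,
rung H3: the Hodge conjecture for every smooth projective variety of `Kum⁴`-type; cell home
run/shared/lean/pub/hodge-kum4/, graded input list HOME/lit/LIT-GRADES-r1.md row L2.1): Grothendieck's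
standard conjecture `B(X)` for projective hyper-Kähler varieties of generalized Kummer type `Kumⁿ` whenever
`n + 1` is PRIME — in particular for `Kum⁴`-type (`n + 1 = 5`).  This is the input that makes the
tensor category of homological motives `⟨h(X)⟩` semisimple abelian Tannakian (Jannsen / André / Arapura),
so that the dual Lefschetz operator `Λ`, the Künneth projectors and the weight grading are algebraic
correspondences — lemma L2 ("motivic bookkeeping") of the cell's blueprint.  Recorded on the tree's real
carriers symbol for symbol as the Charles–Markman record for `K3^[n]`-type
(`CharlesMarkman2013_lefschetzStandard_K3HilbertType`, file `K3HilbertTypeLefschetzStandard`) and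
Lieberman's theorem for abelian varieties (`HodgeTheory.Lieberman1968_lefschetzInvolution_algebraic_abelianVariety`).

## Source (read: arXiv text `paper:arxiv-2303.14327`, materialised pages p0002, p0025)

J. Foster, *The Lefschetz standard conjectures for IHSMs of generalized Kummer deformation type in certain
degrees*, Eur. J. Math. 10 (2024), no. 2, Art. 34, doi:10.1007/s40879-024-00744-2 (arXiv:2303.14327)
[`Foster2024`; REFEREED].  The arXiv text numbers all statements with one counter; we cite by it.
* §1.1, the statement of `B(X)` used (Grothendieck), verbatim (p0002): "Let `X` be a smooth projective
  variety of dimension `n` over `ℂ`, and let the cohomological operator `L` be given by taking the cup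
  product with `c₁(𝒪_X(1))`. […] **Lefschetz standard conjecture `B(X)`.** For each `k ≤ n`, there exists an
  algebraic self-correspondence `[𝒵] ∈ H^{2k}(X × X, ℚ)`, arising from a codimension-`k` cycle
  `𝒵 ∈ CH^k(X × X)`, such that the isomorphism `[𝒵]^* : H^{2n-k}(X, ℚ) → H^k(X, ℚ)` is the inverse of the
  isomorphism `L^{n-k}`.  If the correspondence `[𝒵]` exists for a particular `k ≤ n`, the Lefschetz
  standard conjecture `B(X)` is said to hold for `X` in degree `k`, and […] is said to hold for `X` if it
  holds in all degrees. […] We note also that the statement of the LSC is independent of the choice of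
  polarization on `X` ([K1])."
* **Theorem 1** (= Theorem 86, p0002 L26–L27 / p0025 L33–L34), verbatim: "Let `Y` be a projective
  irreducible holomorphic symplectic manifold (IHSM) of generalized Kummer deformation type of dimension
  `2n`. Let `j` be the smallest prime number dividing `n+1`. Then the Lefschetz standard conjectures hold
  for `Y` in degrees `< 2(n+1)(j-1)/j`."
* **Corollary 2** (p0002 L29–L32), verbatim: "When `n+1` is prime, `j = n+1` and we have the following
  immediate corollary: For `Y` a projective IHSM of generalized Kummer deformation type of dimension `2n`
  for which `n+1` is prime, the Lefschetz standard conjectures hold for `Y`."  (Remark 88, p0025: for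
  `n + 1` prime the degrees `k < 2n` come from Theorem 1 and the middle degree `k = 2n` from the diagonal.)

## Rendering (tree carriers) and faithfulness

* "projective IHSM of generalized Kummer deformation type of dimension `2n`":
  `Motives.IsSmoothProjective (2 * n) X ∧ IsOfGeneralizedKummerType n X` (file `GeneralizedKummerType`:
  deformation equivalent to Beauville's `Kⁿ(A)` of an abelian surface; the companion smooth-projective
  hypothesis exactly as in the `Kum²`/`Kum³` Hodge records of `GeneralizedKummerTypeHodgeConjecture`).
  Foster's "IHSM" (simply connected, `H⁰(Ω²)` spanned by a symplectic form) is a CONSEQUENCE for every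
  compact Kähler deformation of `Kⁿ(A)`, `n ≥ 2` (Beauville 1983 §7 Théorème 4 with Prop. 8), so the
  rendering asks no more than print; for `n + 1` prime we have `n ≥ 1`, and `n = 1` (`K¹(A)` = the Kummer
  surface, `Kum¹`-type = K3 surfaces) is covered in print by Grothendieck's `B` for surfaces (Lefschetz
  (1,1)), so quantifying over all `n` with `n + 1` prime claims nothing beyond print.
* "the Lefschetz standard conjectures hold for `Y`": `∀ η, HodgeTheory.StandardConjectureBStar (2 * n) X η`
  — André's `*_L`-form of `B(X)` on the real carriers `H•(X(ℂ); ℂ)` (file `HodgeTheory/MotivatedClasses`):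
  for every polarisation class `η` (the predicate is vacuous for other `η`) and all `a + b = 4n`, the
  Lefschetz involution `*_L : Hᵃ → Hᵇ` is induced by an algebraic class on `X × X`.  Foster's formulation
  asks, for `k ≤ 2n`, for an algebraic inverse of `L^{2n-k} : Hᵏ → H^{4n-k}`, i.e. exactly the
  degree-`a > 2n` half of `*_L`; the degree-`a ≤ 2n` half `*_L = L^{2n-a}` (`lefschetzInvolution_apply_of_le`)
  is algebraic outright — the standing identification "`B` ⟺ `*_L` algebraic ⟺ `Λ` algebraic" of
  `LefschetzStandardConjectureFacts` (André 1996 Prop. 1.2; Kleiman 1968 §2), Faithfulness note 1 there.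
  POLARISATIONS: Foster states `B(Y)` for `c₁(𝒪_Y(1))` and records its independence of the polarisation
  ([K1] = Kleiman); the tree's predicate quantifies over `IsPolarizationClass` — the identical convention
  under which Lieberman's and Charles–Markman's theorems are recorded.
* COEFFICIENTS: print is over `ℚ`; the carriers are `ℂ`-valued singular cohomology with the algebraic
  classes the `ℂ`-span of cycle classes, as everywhere in `HodgeTheory/*` (a rational correspondence is
  in particular a complex one; nothing stronger than print is asserted).

## What is NOT here

Theorem 1 in composite `n + 1` (degree-restricted `B`; it would need a degree-wise `*_L` predicate) and
Corollary 3 (`n + 1 ≥ 4` even: degrees `< n + 1`); the companion statement "the standard conjectures hold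
for `M_X = (X × T_X)/Γₙ`" and "for the motive `h(X)^{Γₙ}`" (Floccari–Varesco 2024 Thm. 3.1 / Rem. 3.2,
every `n`), which needs Markman's fourfold `T_X` and the `Γₙ`-action as carriers; the conditional
extension to all `Kum^{2d}`-type (arXiv:2512.04114, contingent on Buchweitz–Flenner); any proof (Foster:
Markman's universal family of moduli spaces of sheaves on abelian surfaces, Verbitsky's hyperholomorphic
sheaves, surjectivity of restriction `H*(𝓜_t) → H*(Y_t)^Γ` in the stated degrees, and the decomposition
theorem — XL in the tree).
-/

noncomputable section

namespace Literature.AlgebraicGeometry.Hyperkaehler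

/-- **Foster 2024, Corollary 2 (of Theorem 1): Grothendieck's `B(X)` — the Lefschetz involution `*_L` is
given by an algebraic correspondence — holds for every smooth projective complex variety `X` of
`Kumⁿ`-type whenever `n + 1` is prime** (the printed sentence of Cor. 2, Foster's formulation of
`B(X)` and the reading of "IHSM" are quoted verbatim in the module docstring).  Rendering: for
every `n` with `n + 1` prime, every `X` smooth projective of dimension `2n` over `ℂ`
(`Motives.IsSmoothProjective (2 * n) X`) of `Kumⁿ`-type (`IsOfGeneralizedKummerType n X`) and every
`η ∈ H²(X(ℂ); ℂ)`, the tree's `*_L`-algebraicity predicate holds (the body's head symbol) — i.e. for every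
polarisation class `η` (vacuous otherwise) and all `a + b = 4n`, André's Lefschetz involution
`*_L : Hᵃ(X(ℂ)) → Hᵇ(X(ℂ))` is induced by an algebraic class on `X × X`; independence of the polarisation
is Kleiman 1968 / André 1996 §3.2 (the convention of `HodgeTheory.Lieberman1968_lefschetzInvolution_algebraic_abelianVariety`
and `CharlesMarkman2013_lefschetzStandard_K3HilbertType`, identical spelling).  A THEOREM in print
(REFEREED: Eur. J. Math. 2024; unproved in the tree). [cite: Foster2024, Cor. 2 (§1.1, arXiv:2303.14327 p. 2) of Thm. 1 (= Thm. 86)]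
[cite: Andre1996Motifs, Prop. 1.2 (p. 11) and §3.2 Remarque (p. 21)] -/
def Foster2024_lefschetzStandard_kummerType_prime : Prop :=
  ∀ (n : ℕ), (n + 1).Prime → ∀ ⦃X : Motives.SchemeOver ℂ⦄, Motives.IsSmoothProjective (2 * n) X →
    IsOfGeneralizedKummerType n X →
      ∀ η : HodgeTheory.complexBetti X 2, HodgeTheory.StandardConjectureBStar (2 * n) X η

namespace Foster2024_lefschetzStandard_kummerType_prime

/-- Kernel consequence, `Kum⁴`-type spelling (`n + 1 = 5` prime): `B` (algebraicity of `*_L`) for every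
smooth projective eightfold of `Kum⁴`-type — the case used by the cell `hodge-kum4` (lemma L2).
[cite: Foster2024, Cor. 2 (§1.1)] -/
theorem kum4Type (h : Foster2024_lefschetzStandard_kummerType_prime) {X : Motives.SchemeOver ℂ}
    (hX : Motives.IsSmoothProjective 8 X) (hK : IsOfGeneralizedKummerType 4 X)
    (η : HodgeTheory.complexBetti X 2) : HodgeTheory.StandardConjectureBStar 8 X η :=
  h 4 Nat.prime_five hX hK η

/-- Kernel consequence, `Kum²`-type spelling (`n + 1 = 3` prime): `B` for every smooth projective
fourfold of `Kum²`-type (`IsOfGeneralizedKummerFourfoldType`). [cite: Foster2024, Cor. 2 (§1.1)] -/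
theorem kum2Type (h : Foster2024_lefschetzStandard_kummerType_prime) {X : Motives.SchemeOver ℂ}
    (hX : Motives.IsSmoothProjective 4 X) (hK : IsOfGeneralizedKummerFourfoldType X)
    (η : HodgeTheory.complexBetti X 2) : HodgeTheory.StandardConjectureBStar 4 X η :=
  h 2 Nat.prime_three hX hK η

/-- Kernel consequence, `Kum⁶`-type spelling (`n + 1 = 7` prime): `B` for every smooth projective
twelvefold of `Kum⁶`-type (the next prime case of the cell's `n ≥ 5` outlook). [cite: Foster2024, Cor. 2 (§1.1)] -/
theorem kum6Type (h : Foster2024_lefschetzStandard_kummerType_prime) {X : Motives.SchemeOver ℂ}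
    (hX : Motives.IsSmoothProjective 12 X) (hK : IsOfGeneralizedKummerType 6 X)
    (η : HodgeTheory.complexBetti X 2) : HodgeTheory.StandardConjectureBStar 12 X η :=
  h 6 (by decide) hX hK η

end Foster2024_lefschetzStandard_kummerType_prime

end Literature.AlgebraicGeometry.Hyperkaehler

end
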